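import Summits.SmoothPoincare4.SmoothPoincare4.Theorems.ConvexBisectionAcyclicBisectionExistsPageTwistingTransverse
import HarnessLib

/-!
# The Kähler pairing `⟪V, iT⟫` on `ℂ²` and the sign rule at a crossing of two charted page curves
(wave 3, brick Z6-6 — the orientation step (δ) of the missing lemma `crossingNumber_eq_stdSymp`
of node N1a `node_M3c_shadow_pageDehnTwist` (Picard–Lefschetz on shadows) of stub
`stub_modelsOnFibred_of_reach` = NF4, line `modp-braid-orbits`, crux
`ConvexBisection.AcyclicBisectionExists`, item stmt-SmoothPoincare4-10508; registered sub-goal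
`helper_crossing_sign_antisymm`)

The orientation hypothesis of node N1a on an annulus chart `φ` of a page is
`0 < ⟪∂ᵣφ, i ∂ᵤφ⟫` (`cplxJ` the complex structure of `ℂ² = ℝ⁴`): the frame `(∂ᵤφ, ∂ᵣφ)` is
positive for the complex orientation of the page.  The pairing `ω(T, V) = ⟪V, i T⟫` is the
standard Kähler form of `ℂ²`; this file records its elementary algebra and the one consequence the
symmetry step of the missing lemma consumes:

* §1 `cplxJ_add`, `cplxJ_smul`, **`inner_cplxJ_antisymm`** (`⟪V, iT⟫ = −⟪T, iV⟫`),
  `inner_cplxJ_self` (`⟪V, iV⟫ = 0`), `inner_add_smul_cplxJ` (expansion in a frame);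
* §2 **`crossing_sign_antisymm`** / `helper_crossing_sign_antisymm` — THE SIGN RULE: let
  `(e₁, e₂)` and `(f₁, f₂)` be two positive frames (`0 < ⟪e₂, i e₁⟫`, `0 < ⟪f₂, i f₁⟫`; in the
  application: the frames `(∂ᵤφ, ∂ᵣφ)`, `(∂ᵤψ, ∂ᵣψ)` of two positively oriented annulus charts at
  a common point of their core / level curves) with `f₁ = α e₁ + β e₂` and `e₁ = γ f₁ + δ f₂`
  (`β` = the `φ`-transverse velocity of the second curve, `δ` = the `ψ`-transverse velocity of the
  first, by the chain rule through the transition map).  Then `β ⟪e₂, i e₁⟫ = −δ ⟪f₂, i f₁⟫`, so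
  **`β` and `δ` have opposite signs** (and vanish together): where the second curve crosses the
  first upwards, the first crosses the second downwards.  This is the local content of the
  antisymmetry `crossingNumber φ b = −crossingNumber ψ a` of crossing numbers of positively
  charted page curves, i.e. of the intersection pairing of the page.

Everything is proved; no definitions, no named facts, no `sorry`.  References: B. Farb,
D. Margalit, *A primer on mapping class groups* (2012), §6.1 (algebraic intersection number is
alternating) [FarbMargalit2012]; P. Griffiths, J. Harris, *Principles of Algebraic Geometry*
(1978), Ch. 0 §2 (the Kähler form of `ℂⁿ`; complex submanifolds are positively oriented)
[GriffithsHarris1978].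
-/

noncomputable section

set_option linter.dupNamespace false

open scoped ComplexConjugate
open Literature.Topology.FourManifolds Literature.Topology.FourManifolds.LefschetzBase

namespace Summit.SmoothPoincare4.SmoothPoincare4.Theorems.AcyclicBisectionExists.ModpBraidOrbits

/-! ## §1 The Kähler pairing `⟪V, iT⟫` -/

/-- `i` is additive. [folklore] -/
theorem cplxJ_add (V T : EuclideanSpace ℝ (Fin 4)) : cplxJ (V + T) = cplxJ V + cplxJ T := by
  apply ext_cx_cy
  · rw [cx_cplxJ, cx_add, cx_add, cx_cplxJ, cx_cplxJ, mul_add]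
  · rw [cy_cplxJ, cy_add, cy_add, cy_cplxJ, cy_cplxJ, mul_add]

/-- `i` is real-homogeneous. [folklore] -/
theorem cplxJ_smul (t : ℝ) (V : EuclideanSpace ℝ (Fin 4)) : cplxJ (t • V) = t • cplxJ V := by
  apply ext_cx_cy
  · rw [cx_cplxJ, cx_smul, cx_smul, cx_cplxJ]; ring
  · rw [cy_cplxJ, cy_smul, cy_smul, cy_cplxJ]; ring

/-- **The Kähler pairing is alternating**: `⟪V, iT⟫ = −⟪T, iV⟫`. [cite: GriffithsHarris1978, Ch. 0 §2] -/
theorem inner_cplxJ_antisymm (V T : EuclideanSpace ℝ (Fin 4)) :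
    inner ℝ V (cplxJ T) = -inner ℝ T (cplxJ V) := by
  rw [inner_cplxJ, inner_cplxJ]
  have e : cx T * conj (cx V) + cy T * conj (cy V) = conj (cx V * conj (cx T) + cy V * conj (cy T)) := by
    simp only [map_add, map_mul, Complex.conj_conj]; ring
  rw [e, Complex.conj_im, neg_neg]

/-- `⟪V, iV⟫ = 0`. [folklore] -/
theorem inner_cplxJ_self (V : EuclideanSpace ℝ (Fin 4)) : inner ℝ V (cplxJ V) = 0 := by
  have h := inner_cplxJ_antisymm V V
  linarith

/-- Expansion of the pairing of a combination `α e₁ + β e₂` against `i e₁`: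
`⟪α e₁ + β e₂, i e₁⟫ = β ⟪e₂, i e₁⟫`. [folklore] -/
theorem inner_add_smul_cplxJ (e₁ e₂ : EuclideanSpace ℝ (Fin 4)) (α β : ℝ) :
    inner ℝ (α • e₁ + β • e₂) (cplxJ e₁) = β * inner ℝ e₂ (cplxJ e₁) := by
  rw [inner_add_left, real_inner_smul_left, real_inner_smul_left, inner_cplxJ_self, mul_zero,
    zero_add]

/-! ## §2 The sign rule at a crossing -/

/-- **The transverse velocities of two positively framed curves at a common point are opposite in
sign**: for positive frames `(e₁, e₂)`, `(f₁, f₂)` (`0 < ⟪e₂, i e₁⟫`, `0 < ⟪f₂, i f₁⟫`) with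
`f₁ = α e₁ + β e₂` and `e₁ = γ f₁ + δ f₂`, `β ⟪e₂, i e₁⟫ = −δ ⟪f₂, i f₁⟫`.
[cite: FarbMargalit2012, §6.1] -/
theorem crossing_velocity_relation {e₁ e₂ f₁ f₂ : EuclideanSpace ℝ (Fin 4)} {α β γ δ : ℝ}
    (h₁ : f₁ = α • e₁ + β • e₂) (h₂ : e₁ = γ • f₁ + δ • f₂) :
    β * inner ℝ e₂ (cplxJ e₁) = -(δ * inner ℝ f₂ (cplxJ f₁)) := by
  have a : inner ℝ f₁ (cplxJ e₁) = β * inner ℝ e₂ (cplxJ e₁) := by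
    conv_lhs => rw [h₁]
    exact inner_add_smul_cplxJ e₁ e₂ α β
  have b : inner ℝ e₁ (cplxJ f₁) = δ * inner ℝ f₂ (cplxJ f₁) := by
    conv_lhs => rw [h₂]
    exact inner_add_smul_cplxJ f₁ f₂ γ δ
  rw [← a, ← b, inner_cplxJ_antisymm]

/-- **The sign rule at a crossing**: with the hypotheses of `crossing_velocity_relation` and both
frames positive, `β > 0 ↔ δ < 0`, `β < 0 ↔ δ > 0`, `β = 0 ↔ δ = 0`. [cite: FarbMargalit2012, §6.1] -/
theorem crossing_sign_antisymm {e₁ e₂ f₁ f₂ : EuclideanSpace ℝ (Fin 4)} {α β γ δ : ℝ}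
    (he : 0 < inner ℝ e₂ (cplxJ e₁)) (hf : 0 < inner ℝ f₂ (cplxJ f₁))
    (h₁ : f₁ = α • e₁ + β • e₂) (h₂ : e₁ = γ • f₁ + δ • f₂) :
    (0 < β ↔ δ < 0) ∧ (β < 0 ↔ 0 < δ) ∧ (β = 0 ↔ δ = 0) := by
  have key := crossing_velocity_relation h₁ h₂
  refine ⟨⟨fun h => ?_, fun h => ?_⟩, ⟨fun h => ?_, fun h => ?_⟩, ⟨fun h => ?_, fun h => ?_⟩⟩
  · by_contra h'; push Not at h'; nlinarith [key, mul_pos h he, mul_nonneg h' hf.le]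
  · by_contra h'; push Not at h'
    nlinarith [key, mul_neg_of_neg_of_pos h hf, mul_nonpos_iff.2 (Or.inr ⟨h', he.le⟩)]
  · by_contra h'; push Not at h'
    nlinarith [key, mul_neg_of_neg_of_pos h he, mul_nonpos_iff.2 (Or.inr ⟨h', hf.le⟩)]
  · by_contra h'; push Not at h'; nlinarith [key, mul_pos h hf, mul_nonneg h' he.le]
  · subst h
    rw [zero_mul, zero_eq_neg] at key
    rcases mul_eq_zero.1 key with h | h
    · exact h
    · exact absurd h hf.ne'
  · subst h
    rw [zero_mul, neg_zero] at key
    rcases mul_eq_zero.1 key with h | h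
    · exact h
    · exact absurd h he.ne'

/-! ## §3 The registered form -/

/-- **Sub-goal `helper_crossing_sign_antisymm`** (Z6-6, the orientation step (δ) of the missing
lemma of node N1a of NF4): at a common point of two page curves carrying positively oriented
annulus charts (frames `(e₁, e₂) = (∂ᵤφ, ∂ᵣφ)`, `(f₁, f₂) = (∂ᵤψ, ∂ᵣψ)` with `0 < ⟪e₂, i e₁⟫`,
`0 < ⟪f₂, i f₁⟫`), the transverse velocity `β` of the second core in the first chart
(`f₁ = α e₁ + β e₂`) and the transverse velocity `δ` of the first core in the second chart
(`e₁ = γ f₁ + δ f₂`) have opposite signs: `0 < β ↔ δ < 0` and `β < 0 ↔ 0 < δ`.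
[cite: FarbMargalit2012, §6.1] -/
theorem helper_crossing_sign_antisymm : ∀ (e₁ e₂ f₁ f₂ : EuclideanSpace ℝ (Fin 4)) (α β γ δ : ℝ), 0 < inner ℝ e₂ (Literature.Topology.FourManifolds.LefschetzBase.cplxJ e₁) → 0 < inner ℝ f₂ (Literature.Topology.FourManifolds.LefschetzBase.cplxJ f₁) → f₁ = α • e₁ + β • e₂ → e₁ = γ • f₁ + δ • f₂ → (0 < β ↔ δ < 0) ∧ (β < 0 ↔ 0 < δ) :=
  fun _ _ _ _ _ _ _ _ he hf h₁ h₂ =>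
    ⟨(crossing_sign_antisymm he hf h₁ h₂).1, (crossing_sign_antisymm he hf h₁ h₂).2.1⟩

end Summit.SmoothPoincare4.SmoothPoincare4.Theorems.AcyclicBisectionExists.ModpBraidOrbits

end
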